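import Summits.BirchSwinnertonDyer.BirchSwinnertonDyer.Theorems.GenusKolyvaginAtTwoPowDvdShaCardAtTwoRTDeepOwnPrimeCondition
import Summits.BirchSwinnertonDyer.BirchSwinnertonDyer.Theorems.GenusKolyvaginAtTwoPowDvdShaCardAtTwoRTBottomRungReciprocity
import Summits.BirchSwinnertonDyer.BirchSwinnertonDyer.Theorems.GenusKolyvaginAtTwoEquivariantKolyvaginExactAtTwoTwinGrossPrimes
import HarnessLib

/-!
# Route `GenusKolyvaginAtTwo`, crux L_T `PowDvdShaCardAtTwoRT` (stmt-BirchSwinnertonDyer-23242), LINE 18 stub L, bottom rung: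
# THE AUXILIARY CLASS OF THE S-bot ENGINE WITH THE DEEP-OWN-PRIME ORTHOGONALITY BUILT IN, AND THE RECIPROCITY STEP
# IT FEEDS (the `l′`-term vanishes)

Width seat `bsd-line-gk2-p4` g18 (cell `bsd-f1-sign2`), `--supports 23242 --as helper`.  THEOREMS ONLY (no definition, no named
fact, no `sorry`; standard axioms).  BSD is NOT proved by any of this; neither is the crux nor stub L.

WHY (LEAD memo `Cruxes/PowDvdShaCardAtTwoRT/Lines/plus-descent-lead-g16.md` §2 CLAIM «`𝒴₄` contains a class `y` with `2y ≠ 0`», §7 (i),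
§8).  The bottom-rung engine for an index-≥2 `k`-minimal witness `n = s·t` (`s` the `k ≥ 1` non-deep own primes, `t` the deep ones)
needs an auxiliary `y ∈ H¹(ℚ, E^ε[4])`, Kummer off `n`, FREE at the places of `s`, such that `2•y ≠ 0` AND, at every deep own prime
`ℓ ∈ t`, `⟨loc_ℓ(2•Z), loc_ℓ y⟩ = 0` for the later-chosen Kolyvagin class `Z` (whose only property used at `ℓ` is «`2•Z` is
TRANSVERSE at `ℓ`», gk2-p3's I7 currency / memo §8 «`2·[Z_ℓ]_f = 0`»).  This file assembles exactly that class from the two sockets of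
this seat: the count under arbitrary local conditions (`…RTOrderFourAuxiliaryConstrained`, p701795) and the ∃-form local condition at a
deep own prime (`…RTDeepOwnPrimeCondition`, p703074):
* **`exists_auxiliary_four_two_nsmul_ne_zero_deep`** — `E/ℚ` globally minimal with `Δ < 0` and `ρ̄_{E,2}` onto; `T ⊇ s ≠ ∅` finite
  sets of places of Gross–Kolyvagin primes `ℓ ≠ 2` of good reduction with `Frob_ℓ = Frob_∞` on `E[2]` and `kolyvaginIndex ≥ 2`, and at
  the places of `T ∖ s` moreover `Frob_ℓ = Frob_∞` on `E[4]` (`FrobEqFrobInfty W K 4 ℓ`); `inv_v` injective on `T`.  Then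
  **`∃ y ∈ H¹_{𝓛,⊤ on T}(ℚ, E[4])` with `2•y ≠ 0` and, for every place `v ∈ T ∖ s` and every global `Z` with `2•Z` transverse at `v`
  (`∀ 𝔓 ∣ v, ∀ F, c₀ …, [2•Z, F] ∈ (F − 1)E[4]`), `inv_v(loc_v(2•Z) ∪ₑ loc_v y) = 0`.**
* `exists_auxiliary_four_two_nsmul_ne_zero_deep_of_frobenius` — the same with a FIXED Frobenius datum `(𝔐_v, F_v)` at each deep place
  (transversality of `2•Z` only w.r.t. `F_v`; no level-`4` `FrobEqFrobInfty` needed).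
* §2 `invWeilPairing_eq_zero_of_bottomRung_of_vanishing` (any number field, any level): the LEAD's reciprocity step p701715 with the
  `t`-terms in VANISHING form (`inv_u(loc_u X ∪ loc_u y) = 0` on `t`) instead of the isotropic-`L_u` form; `kummerOutside_mono`.
* §3 **`exists_auxiliary_bottomRung`** — §1 + §2: for `s` (free, non-empty) and `t` (deep) as above and `inv` with `SumLocalTermEqZero`:
  `∃ y ∈ H¹_{𝓛,⊤ on s∪t}(ℚ, E[4])`, `2•y ≠ 0`, such that for EVERY `l′ ∉ s ∪ t` and EVERY `Z` with `2•Z` Kummer off `s ∪ t ∪ {l′}`,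
  `loc(2•Z) = 0` on `s` and `2•Z` transverse on `t`: **`inv_{l′}(loc_{l′}(2•Z) ∪ₑ loc_{l′} y) = 0`** — the engine's contradiction is then
  the NON-vanishing of that term (LEAD: Q2 + pair Čebotarev + `pairing_two_nsmul_ne_zero_of_lagrangian`).
* §4 `exists_auxiliary_bottomRung_twin` — the same on the twin `Wd ≅ E^{(d_K)}` (transfer block of the LEAD's p701030).
HONEST FRAMING: bookkeeping over p701795 / p703074 / p698989 (tree theorems); the arithmetic input «`2•Z` transverse at the deep own
primes» and the reciprocity assembly (memo §2 (ii)) are NOT here; closes nothing.  BSD is NOT proved by any of this.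

References: [McCallumLMS1991] §2 Prop. 2.1, §5 Lemma 5.3 and proof of Prop. 5.2 (13); [MilneADT2006] Ch. I Cor. 2.3, Thm. 2.8, Thm. 4.10.
-/

set_option autoImplicit false
-- the Theorems namespace of this sub repeats the summit name by design (D-0017 nested layout)
set_option linter.dupNamespace false

noncomputable section

open scoped Classical

open CategoryTheory Field NumberField IsDedekindDomain Function
open _root_.WeierstrassCurve
open Literature.NumberTheory.EllipticCurves
open Literature.NumberTheory.GaloisRepresentations
open Literature.NumberTheory.GaloisCohomology
open Summit.BirchSwinnertonDyer.Rank1Residual.X11b.KummerPT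
open Summit.BirchSwinnertonDyer.Rank1Residual.X11b.FiniteDuality
open Summit.BirchSwinnertonDyer.Rank1Residual.X11b.Relaxation
open scoped ContRepresentation

namespace Summit.BirchSwinnertonDyer.BirchSwinnertonDyer.Theorems.GenusExact.DeepOwnPrime

open Summit.BirchSwinnertonDyer.BirchSwinnertonDyer.Theorems.GenusExact.RelaxedCount

/-! ## §1 The auxiliary class with the deep-own-prime orthogonality -/

section Auxiliary

variable (W : WeierstrassCurve ℚ) [W.IsElliptic] [W.IsGloballyMinimal]
variable (e : geomTorsion W ((2 ^ 2 : ℕ) : ℤ) → geomTorsion W ((2 ^ 2 : ℕ) : ℤ) → AlgebraicClosure ℚ)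
  (hμ : ∀ S T, e S T ^ (2 ^ 2) = 1)
  (hadd₁ : ∀ S₁ S₂ T, e (S₁ + S₂) T = e S₁ T * e S₂ T)
  (hadd₂ : ∀ S T₁ T₂, e S (T₁ + T₂) = e S T₁ * e S T₂)
  (hgal : ∀ (σ : absoluteGaloisGroup ℚ) (S T : geomTorsion W ((2 ^ 2 : ℕ) : ℤ)), σ • e S T = e (σ • S) (σ • T))
  (halt : ∀ T, e T T = 1) (hnondeg : ∀ T, (∀ S, e S T = 1) → T = 0)
  (inv : LocalInvariants ℚ (2 ^ 2))

include halt hnondeg in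
/-- **The S-bot auxiliary class with deep orthogonality, fixed Frobenius data.**  `E/ℚ` globally minimal, `Δ < 0`, `ρ̄_{E,2}` onto;
`T` a finite set of places of Gross–Kolyvagin primes (`ℓ ≠ 2`, good, `Frob_ℓ = Frob_∞` on `E[2]`, `kolyvaginIndex ≥ 2`), `s ⊆ T`
NON-EMPTY (the free own primes), `inv_v` injective on `T`, and at every place `v ∈ T ∖ s` a Frobenius datum: `𝔐 v ∈ v.localPrimesAbove`
and `Fr v` an arithmetic Frobenius at the prime of the chosen embedding.  Then **`∃ y ∈ H¹_{𝓛,⊤ on T}(ℚ, E[4])`, `2•y ≠ 0`, such that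
for every `v ∈ T ∖ s` and every global `Z` with `[2•Z, Fr v] ∈ (Fr v − 1)E[4]`: `inv_v(loc_v(2•Z) ∪ₑ loc_v y) = 0`.**  Proof: at the
places of `s` take `M = ⊤` (order 16), at the deep places the `M` of `exists_localCondition_eight_le_rat` (order `≥ 8`), and apply
`exists_mem_kummerOutside_four_two_nsmul_ne_zero_of_free_of_eight_le`. [cite: McCallumLMS1991, §2 Prop. 2.1 and §5 proof of Prop. 5.2 (13)]
[cite: MilneADT2006, Ch. I, Thm. 4.10] -/
theorem exists_auxiliary_four_two_nsmul_ne_zero_deep_of_frobenius (hΔ : W.Δ < 0) (hρ2 : W.HasSurjectiveModNGaloisRep 2)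
    {K : Type} [Field K] [NumberField K] (T s : Finset (Place ℚ)) (hsT : s ⊆ T) (hs : s.Nonempty)
    (hTK : ∀ u ∈ T, ∃ (v : HeightOneSpectrum (𝓞 ℚ)) (ℓ : ℕ) (_ : Fact ℓ.Prime), u = Sum.inr v ∧ ℓ ≠ 2 ∧ (ℓ : 𝓞 ℚ) ∈ v.asIdeal ∧
      W.HasGoodReductionAtPrime ℓ ∧ FrobEqFrobInfty W K 2 ℓ ∧ 2 ≤ Zhang2014.kolyvaginIndex W 2 ℓ)
    (hinv : ∀ v : HeightOneSpectrum (𝓞 ℚ), Sum.inr v ∈ T → Injective (inv (Sum.inr v)))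
    (𝔐 : ∀ v : HeightOneSpectrum (𝓞 ℚ), Ideal (HeightOneSpectrum.localAbsIntegers v))
    (Fr : HeightOneSpectrum (𝓞 ℚ) → absoluteGaloisGroup ℚ)
    (h𝔐 : ∀ v : HeightOneSpectrum (𝓞 ℚ), Sum.inr v ∈ T → Sum.inr v ∉ s → 𝔐 v ∈ v.localPrimesAbove)
    (hFr : ∀ v : HeightOneSpectrum (𝓞 ℚ), Sum.inr v ∈ T → Sum.inr v ∉ s →
      IsArithFrobAt (𝓞 ℚ) (Fr v) (v.primeBelow (closureEmb (K := ℚ) (v.adicCompletion ℚ)) (𝔐 v))) :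
    ∃ y ∈ kummerOutside W (2 ^ 2) T, 2 • y ≠ 0 ∧
      ∀ v : HeightOneSpectrum (𝓞 ℚ), Sum.inr v ∈ T → Sum.inr v ∉ s →
        ∀ Z : galoisCohomology (W.torsionGaloisModule ((2 ^ 2 : ℕ) : ℤ)) 1,
          (∃ P : geomTorsion W ((2 ^ 2 : ℕ) : ℤ), h1Eval W _ ((2 : ℕ) • Z) (Fr v) = Fr v • P - P) →
          invWeilPairing W (2 ^ 2) e hμ hadd₁ hadd₂ hgal inv (Sum.inr v)
            (galoisCohomology.localization (W.torsionGaloisModule ((2 ^ 2 : ℕ) : ℤ)) (Sum.inr v) 1 ((2 : ℕ) • Z))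
            (galoisCohomology.localization (W.torsionGaloisModule ((2 ^ 2 : ℕ) : ℤ)) (Sum.inr v) 1 y) = 0 := by
  classical
  -- Step 1: a local condition at every place of `T`
  have key : ∀ u : ↥T, ∃ M : AddSubgroup (galoisCohomology ((W.torsionGaloisModule ((2 ^ 2 : ℕ) : ℤ)).toLocal (u : Place ℚ)) 1),
      8 ≤ Nat.card M ∧ ((u : Place ℚ) ∈ s → M = ⊤) ∧
      (∀ v : HeightOneSpectrum (𝓞 ℚ), (u : Place ℚ) = Sum.inr v → (u : Place ℚ) ∉ s →
        ∀ Z : galoisCohomology (W.torsionGaloisModule ((2 ^ 2 : ℕ) : ℤ)) 1,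
          (∃ P : geomTorsion W ((2 ^ 2 : ℕ) : ℤ), h1Eval W _ ((2 : ℕ) • Z) (Fr v) = Fr v • P - P) →
          ∀ y : galoisCohomology (W.torsionGaloisModule ((2 ^ 2 : ℕ) : ℤ)) 1,
            galoisCohomology.localization (W.torsionGaloisModule ((2 ^ 2 : ℕ) : ℤ)) (u : Place ℚ) 1 y ∈ M →
            invWeilPairing W (2 ^ 2) e hμ hadd₁ hadd₂ hgal inv (Sum.inr v)
              (galoisCohomology.localization (W.torsionGaloisModule ((2 ^ 2 : ℕ) : ℤ)) (Sum.inr v) 1 ((2 : ℕ) • Z))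
              (galoisCohomology.localization (W.torsionGaloisModule ((2 ^ 2 : ℕ) : ℤ)) (Sum.inr v) 1 y) = 0) := by
    rintro ⟨u, huT⟩
    obtain ⟨v, ℓ, hℓp, hu, hℓ2, hv, hgood, hFrob, hidx⟩ := hTK u huT
    subst hu
    have h16 : Nat.card (galoisCohomology ((W.torsionGaloisModule ((2 ^ 2 : ℕ) : ℤ)).toLocal (Sum.inr v)) 1) = 16 := by
      rw [natCard_galoisCohomology_one_toLocal_two_pow_eq W hΔ hℓ2 hgood hFrob hv two_ne_zero hidx]; norm_num
    by_cases hus : (Sum.inr v : Place ℚ) ∈ s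
    · refine ⟨⊤, ?_, fun _ ↦ rfl, fun _ _ h ↦ (h hus).elim⟩
      change 8 ≤ Nat.card (⊤ : AddSubgroup (galoisCohomology ((W.torsionGaloisModule ((2 ^ 2 : ℕ) : ℤ)).toLocal (Sum.inr v)) 1))
      rw [AddSubgroup.card_top, h16]; norm_num
    · obtain ⟨M, hM8, hM⟩ := exists_localCondition_eight_le_rat W e hμ hadd₁ hadd₂ hgal halt hnondeg inv hΔ hℓ2 hgood hFrob hv
        hidx (hinv v huT) (h𝔐 v huT hus) (hFr v huT hus)
      refine ⟨M, hM8, fun h ↦ (hus h).elim, fun v' hv' _ Z hZ y hy ↦ ?_⟩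
      have hvv' : v = v' := Sum.inr_injective hv'
      subst hvv'
      exact hM Z hZ _ hy
  choose M hM8 hMtop hMdeep using key
  -- Step 2: the order-4 auxiliary under these conditions
  obtain ⟨u₀, hu₀⟩ := hs
  obtain ⟨y, hyKO, hyM, hy2⟩ := exists_mem_kummerOutside_four_two_nsmul_ne_zero_of_free_of_eight_le W hΔ hρ2 T hTK M
    ⟨⟨u₀, hsT hu₀⟩, hMtop _ hu₀⟩ hM8
  refine ⟨y, hyKO, hy2, fun v hvT hvs Z hZ ↦ ?_⟩
  exact hMdeep ⟨Sum.inr v, hvT⟩ v rfl hvs Z hZ y (hyM ⟨Sum.inr v, hvT⟩)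

include halt hnondeg in
/-- **The S-bot auxiliary class with deep orthogonality, `∀`-Frobenius form.**  As
`exists_auxiliary_four_two_nsmul_ne_zero_deep_of_frobenius`, but with `Frob_ℓ = Frob_∞` on `E[4]` (`FrobEqFrobInfty W K 4 ℓ`) at the
places of `T ∖ s` instead of a Frobenius datum, and the transversality of `2•Z` quantified over every prime `𝔓 ∣ v`, every arithmetic
Frobenius `F` there and every complex conjugation `c₀` with `F = c₀` on `E[4]` (gk2-p3's I7 form): **`∃ y ∈ H¹_{𝓛,⊤ on T}(ℚ, E[4])`,
`2•y ≠ 0`, orthogonal at every deep place to `loc(2•Z)` for every such `Z`.**  This is the CLAIM of the LEAD's memo §2 («`𝒴₄` contains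
a class `y` with `2y ≠ 0`») with the `t`-orthogonality of §8 built in. [cite: McCallumLMS1991, §2 Prop. 2.1 and §5 proof of Prop. 5.2 (13)]
[cite: MilneADT2006, Ch. I, Thm. 4.10] -/
theorem exists_auxiliary_four_two_nsmul_ne_zero_deep (hΔ : W.Δ < 0) (hρ2 : W.HasSurjectiveModNGaloisRep 2)
    {K : Type} [Field K] [NumberField K] (T s : Finset (Place ℚ)) (hsT : s ⊆ T) (hs : s.Nonempty)
    (hTK : ∀ u ∈ T, ∃ (v : HeightOneSpectrum (𝓞 ℚ)) (ℓ : ℕ) (_ : Fact ℓ.Prime), u = Sum.inr v ∧ ℓ ≠ 2 ∧ (ℓ : 𝓞 ℚ) ∈ v.asIdeal ∧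
      W.HasGoodReductionAtPrime ℓ ∧ FrobEqFrobInfty W K 2 ℓ ∧ 2 ≤ Zhang2014.kolyvaginIndex W 2 ℓ)
    (ht4 : ∀ (v : HeightOneSpectrum (𝓞 ℚ)) (ℓ : ℕ), ℓ.Prime → Sum.inr v ∈ T → Sum.inr v ∉ s → (ℓ : 𝓞 ℚ) ∈ v.asIdeal →
      FrobEqFrobInfty W K (2 ^ 2) ℓ)
    (hinv : ∀ v : HeightOneSpectrum (𝓞 ℚ), Sum.inr v ∈ T → Injective (inv (Sum.inr v))) :
    ∃ y ∈ kummerOutside W (2 ^ 2) T, 2 • y ≠ 0 ∧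
      ∀ v : HeightOneSpectrum (𝓞 ℚ), Sum.inr v ∈ T → Sum.inr v ∉ s →
        ∀ Z : galoisCohomology (W.torsionGaloisModule ((2 ^ 2 : ℕ) : ℤ)) 1,
          (∀ 𝔓 ∈ v.primesAbove, ∀ F c₀ : absoluteGaloisGroup ℚ, IsArithFrobAt (𝓞 ℚ) F 𝔓 →
            IsComplexConjugation (Rat.castHom ℝ) c₀ → (∀ P : geomTorsion W ((2 ^ 2 : ℕ) : ℤ), F • P = c₀ • P) →
            ∃ P₁ : geomTorsion W ((2 ^ 2 : ℕ) : ℤ), h1Eval W _ ((2 : ℕ) • Z) F = F • P₁ - P₁) →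
          invWeilPairing W (2 ^ 2) e hμ hadd₁ hadd₂ hgal inv (Sum.inr v)
            (galoisCohomology.localization (W.torsionGaloisModule ((2 ^ 2 : ℕ) : ℤ)) (Sum.inr v) 1 ((2 : ℕ) • Z))
            (galoisCohomology.localization (W.torsionGaloisModule ((2 ^ 2 : ℕ) : ℤ)) (Sum.inr v) 1 y) = 0 := by
  classical
  -- Step 1: a local condition at every place of `T`
  have key : ∀ u : ↥T, ∃ M : AddSubgroup (galoisCohomology ((W.torsionGaloisModule ((2 ^ 2 : ℕ) : ℤ)).toLocal (u : Place ℚ)) 1),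
      8 ≤ Nat.card M ∧ ((u : Place ℚ) ∈ s → M = ⊤) ∧
      (∀ v : HeightOneSpectrum (𝓞 ℚ), (u : Place ℚ) = Sum.inr v → (u : Place ℚ) ∉ s →
        ∀ Z : galoisCohomology (W.torsionGaloisModule ((2 ^ 2 : ℕ) : ℤ)) 1,
          (∀ 𝔓 ∈ v.primesAbove, ∀ F c₀ : absoluteGaloisGroup ℚ, IsArithFrobAt (𝓞 ℚ) F 𝔓 →
            IsComplexConjugation (Rat.castHom ℝ) c₀ → (∀ P : geomTorsion W ((2 ^ 2 : ℕ) : ℤ), F • P = c₀ • P) →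
            ∃ P₁ : geomTorsion W ((2 ^ 2 : ℕ) : ℤ), h1Eval W _ ((2 : ℕ) • Z) F = F • P₁ - P₁) →
          ∀ y : galoisCohomology (W.torsionGaloisModule ((2 ^ 2 : ℕ) : ℤ)) 1,
            galoisCohomology.localization (W.torsionGaloisModule ((2 ^ 2 : ℕ) : ℤ)) (u : Place ℚ) 1 y ∈ M →
            invWeilPairing W (2 ^ 2) e hμ hadd₁ hadd₂ hgal inv (Sum.inr v)
              (galoisCohomology.localization (W.torsionGaloisModule ((2 ^ 2 : ℕ) : ℤ)) (Sum.inr v) 1 ((2 : ℕ) • Z))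
              (galoisCohomology.localization (W.torsionGaloisModule ((2 ^ 2 : ℕ) : ℤ)) (Sum.inr v) 1 y) = 0) := by
    rintro ⟨u, huT⟩
    obtain ⟨v, ℓ, hℓp, hu, hℓ2, hv, hgood, hFrob, hidx⟩ := hTK u huT
    subst hu
    have h16 : Nat.card (galoisCohomology ((W.torsionGaloisModule ((2 ^ 2 : ℕ) : ℤ)).toLocal (Sum.inr v)) 1) = 16 := by
      rw [natCard_galoisCohomology_one_toLocal_two_pow_eq W hΔ hℓ2 hgood hFrob hv two_ne_zero hidx]; norm_num
    by_cases hus : (Sum.inr v : Place ℚ) ∈ s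
    · refine ⟨⊤, ?_, fun _ ↦ rfl, fun _ _ h ↦ (h hus).elim⟩
      change 8 ≤ Nat.card (⊤ : AddSubgroup (galoisCohomology ((W.torsionGaloisModule ((2 ^ 2 : ℕ) : ℤ)).toLocal (Sum.inr v)) 1))
      rw [AddSubgroup.card_top, h16]; norm_num
    · have hℓ4 : FrobEqFrobInfty W K (2 ^ 2) ℓ := ht4 v ℓ hℓp.out huT hus hv
      obtain ⟨M, hM8, hM⟩ := exists_localCondition_eight_le_forall W e hμ hadd₁ hadd₂ hgal halt hnondeg inv hΔ hℓ2 hgood hℓ4 hv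
        hidx (hinv v huT)
      refine ⟨M, hM8, fun h ↦ (hus h).elim, fun v' hv' _ Z hZ y hy ↦ ?_⟩
      have hvv' : v = v' := Sum.inr_injective hv'
      subst hvv'
      exact hM Z hZ _ hy
  choose M hM8 hMtop hMdeep using key
  -- Step 2: the order-4 auxiliary under these conditions
  obtain ⟨u₀, hu₀⟩ := hs
  obtain ⟨y, hyKO, hyM, hy2⟩ := exists_mem_kummerOutside_four_two_nsmul_ne_zero_of_free_of_eight_le W hΔ hρ2 T hTK M
    ⟨⟨u₀, hsT hu₀⟩, hMtop _ hu₀⟩ hM8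
  refine ⟨y, hyKO, hy2, fun v hvT hvs Z hZ ↦ ?_⟩
  exact hMdeep ⟨Sum.inr v, hvT⟩ v rfl hvs Z hZ y (hyM ⟨Sum.inr v, hvT⟩)

end Auxiliary

/-! ## §2 The `X = 2Z` reciprocity step with the `t`-terms in VANISHING form (variant of the LEAD's p701715) -/

section Reciprocity

variable {K : Type} [Field K] [NumberField K] (W : WeierstrassCurve K) [W.IsElliptic]
variable (n : ℕ) [NeZero n]
variable (e : W.geomTorsion n → W.geomTorsion n → AlgebraicClosure K)
  (hμ : ∀ S T, e S T ^ n = 1)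
  (hadd₁ : ∀ S₁ S₂ T, e (S₁ + S₂) T = e S₁ T * e S₂ T)
  (hadd₂ : ∀ S T₁ T₂, e S (T₁ + T₂) = e S T₁ * e S T₂)
  (hgal : ∀ (σ : absoluteGaloisGroup K) (S T : W.geomTorsion n), σ • e S T = e (σ • S) (σ • T))
  (halt : ∀ T, e T T = 1)

include halt in
/-- **The reciprocity step, `t`-terms in vanishing form.**  As the LEAD's `RelaxedCount.invWeilPairing_eq_zero_of_bottomRung`
(p701715), but the hypothesis at the deep own places `t` is the VANISHING of the local terms `inv_u(loc_u X ∪ₑ loc_u y) = 0` itself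
(as supplied by `exists_auxiliary_four_two_nsmul_ne_zero_deep`), not an isotropic `L_u` with both localisations in `L_u ⊔ H¹[2]`; and
`X` is any class (in the engine `X = 2•Z`).  Conclusion: the `l′`-term vanishes. [cite: McCallumLMS1991, §5 proof of Prop. 5.2 (13)]
[cite: MilneADT2006, Ch. I, Thm. 4.10] -/
theorem invWeilPairing_eq_zero_of_bottomRung_of_vanishing {inv : LocalInvariants K n} (hsum : inv.SumLocalTermEqZero)
    (s t : Finset (Place K)) (l' : Place K) (hl's : l' ∉ s) (hl't : l' ∉ t) (hst : Disjoint s t)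
    {X y : galoisCohomology (W.torsionGaloisModule (n : ℤ)) 1}
    (hX : X ∈ kummerOutside W n (insert l' (s ∪ t))) (hy : y ∈ kummerOutside W n (insert l' (s ∪ t)))
    (hXs : ∀ u ∈ s, galoisCohomology.localization (W.torsionGaloisModule (n : ℤ)) u 1 X = 0)
    (ht : ∀ u ∈ t, invWeilPairing W n e hμ hadd₁ hadd₂ hgal inv u
      (galoisCohomology.localization (W.torsionGaloisModule (n : ℤ)) u 1 X)
      (galoisCohomology.localization (W.torsionGaloisModule (n : ℤ)) u 1 y) = 0) :
    invWeilPairing W n e hμ hadd₁ hadd₂ hgal inv l'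
      (galoisCohomology.localization (W.torsionGaloisModule (n : ℤ)) l' 1 X)
      (galoisCohomology.localization (W.torsionGaloisModule (n : ℤ)) l' 1 y) = 0 := by
  have hrec := sum_invWeilPairing_localization_eq_zero_of_mem_kummerOutside W n e hμ hadd₁ hadd₂ hgal halt inv hsum
    (insert l' (s ∪ t)) hX hy
  have hl'st : l' ∉ s ∪ t := fun h ↦ by
    rcases Finset.mem_union.mp h with h | h
    · exact hl's h
    · exact hl't h
  rw [Finset.sum_insert hl'st, Finset.sum_union hst] at hrec
  have hs0 : ∑ u ∈ s, invWeilPairing W n e hμ hadd₁ hadd₂ hgal inv u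
      (galoisCohomology.localization (W.torsionGaloisModule (n : ℤ)) u 1 X)
      (galoisCohomology.localization (W.torsionGaloisModule (n : ℤ)) u 1 y) = 0 :=
    Finset.sum_eq_zero fun u hu ↦ by rw [hXs u hu, map_zero, AddMonoidHom.zero_apply]
  have ht0 : ∑ u ∈ t, invWeilPairing W n e hμ hadd₁ hadd₂ hgal inv u
      (galoisCohomology.localization (W.torsionGaloisModule (n : ℤ)) u 1 X)
      (galoisCohomology.localization (W.torsionGaloisModule (n : ℤ)) u 1 y) = 0 :=
    Finset.sum_eq_zero fun u hu ↦ ht u hu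
  rw [hs0, ht0, add_zero, add_zero] at hrec
  exact hrec

omit [W.IsElliptic] [NeZero n] in
/-- `kummerOutside` is monotone in the excluded set: fewer conditions for a larger `S`. [folklore] -/
theorem kummerOutside_mono {S S' : Finset (Place K)} (hSS' : S ⊆ S') : kummerOutside W n S ≤ kummerOutside W n S' :=
  fun c hc ↦ (mem_kummerOutside_iff W n S' c).mpr fun v hv ↦ (mem_kummerOutside_iff W n S c).mp hc v fun h ↦ hv (hSS' h)

end Reciprocity

/-! ## §3 The auxiliary AND the reciprocity: the `l′`-term vanishes for the class produced in §1 -/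

section Engine

variable (W : WeierstrassCurve ℚ) [W.IsElliptic] [W.IsGloballyMinimal]
variable (e : geomTorsion W ((2 ^ 2 : ℕ) : ℤ) → geomTorsion W ((2 ^ 2 : ℕ) : ℤ) → AlgebraicClosure ℚ)
  (hμ : ∀ S T, e S T ^ (2 ^ 2) = 1)
  (hadd₁ : ∀ S₁ S₂ T, e (S₁ + S₂) T = e S₁ T * e S₂ T)
  (hadd₂ : ∀ S T₁ T₂, e S (T₁ + T₂) = e S T₁ * e S T₂)
  (hgal : ∀ (σ : absoluteGaloisGroup ℚ) (S T : geomTorsion W ((2 ^ 2 : ℕ) : ℤ)), σ • e S T = e (σ • S) (σ • T))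
  (halt : ∀ T, e T T = 1) (hnondeg : ∀ T, (∀ S, e S T = 1) → T = 0)
  (inv : LocalInvariants ℚ (2 ^ 2))

include halt hnondeg in
/-- **Auxiliary + reciprocity for the S-bot engine (index `≥ 2`), by name.**  `E/ℚ` globally minimal, `Δ < 0`, `ρ̄_{E,2}` onto; `s` (free,
NON-EMPTY) and `t` (deep) disjoint finite sets of places of Gross–Kolyvagin primes (`ℓ ≠ 2`, good, `Frob_ℓ = Frob_∞` on `E[2]`,
`kolyvaginIndex ≥ 2`; on `t` moreover `Frob_ℓ = Frob_∞` on `E[4]`); `inv` a family of local invariant maps with `SumLocalTermEqZero`,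
injective on `s ∪ t`.  Then **there is `y ∈ H¹_{𝓛,⊤ on s ∪ t}(ℚ, E[4])` with `2•y ≠ 0` such that for EVERY further place `l′ ∉ s ∪ t` and
EVERY `Z ∈ H¹(ℚ, E[4])` with `2•Z` Kummer off `s ∪ t ∪ {l′}`, `loc_u(2•Z) = 0` at the places of `s`, and `2•Z` transverse at the places
of `t`: `inv_{l′}(loc_{l′}(2•Z) ∪ₑ loc_{l′} y) = 0`.**  (The engine then contradicts this with the NON-vanishing of the `l′`-term for
`Z = desc c₂(nℓ′)`, `ℓ′` a Čebotarev prime for `(c₂(n), res_K y)` — LEAD.)  Proof: §1 + §2. [cite: McCallumLMS1991, §5 proof of Prop. 5.2]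
[cite: MilneADT2006, Ch. I, Thm. 4.10] -/
theorem exists_auxiliary_bottomRung (hΔ : W.Δ < 0) (hρ2 : W.HasSurjectiveModNGaloisRep 2)
    {K : Type} [Field K] [NumberField K] (s t : Finset (Place ℚ)) (hst : Disjoint s t) (hs : s.Nonempty)
    (hTK : ∀ u ∈ s ∪ t, ∃ (v : HeightOneSpectrum (𝓞 ℚ)) (ℓ : ℕ) (_ : Fact ℓ.Prime), u = Sum.inr v ∧ ℓ ≠ 2 ∧ (ℓ : 𝓞 ℚ) ∈ v.asIdeal ∧
      W.HasGoodReductionAtPrime ℓ ∧ FrobEqFrobInfty W K 2 ℓ ∧ 2 ≤ Zhang2014.kolyvaginIndex W 2 ℓ)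
    (ht4 : ∀ (v : HeightOneSpectrum (𝓞 ℚ)) (ℓ : ℕ), ℓ.Prime → Sum.inr v ∈ t → (ℓ : 𝓞 ℚ) ∈ v.asIdeal →
      FrobEqFrobInfty W K (2 ^ 2) ℓ)
    (hinv : ∀ v : HeightOneSpectrum (𝓞 ℚ), Sum.inr v ∈ s ∪ t → Injective (inv (Sum.inr v)))
    (hsum : inv.SumLocalTermEqZero) :
    ∃ y ∈ kummerOutside W (2 ^ 2) (s ∪ t), 2 • y ≠ 0 ∧
      ∀ l' : Place ℚ, l' ∉ s ∪ t →
        ∀ Z : galoisCohomology (W.torsionGaloisModule ((2 ^ 2 : ℕ) : ℤ)) 1,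
          (2 : ℕ) • Z ∈ kummerOutside W (2 ^ 2) (insert l' (s ∪ t)) →
          (∀ u ∈ s, galoisCohomology.localization (W.torsionGaloisModule ((2 ^ 2 : ℕ) : ℤ)) u 1 ((2 : ℕ) • Z) = 0) →
          (∀ v : HeightOneSpectrum (𝓞 ℚ), Sum.inr v ∈ t →
            ∀ 𝔓 ∈ v.primesAbove, ∀ F c₀ : absoluteGaloisGroup ℚ, IsArithFrobAt (𝓞 ℚ) F 𝔓 →
              IsComplexConjugation (Rat.castHom ℝ) c₀ → (∀ P : geomTorsion W ((2 ^ 2 : ℕ) : ℤ), F • P = c₀ • P) →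
              ∃ P₁ : geomTorsion W ((2 ^ 2 : ℕ) : ℤ), h1Eval W _ ((2 : ℕ) • Z) F = F • P₁ - P₁) →
          invWeilPairing W (2 ^ 2) e hμ hadd₁ hadd₂ hgal inv l'
            (galoisCohomology.localization (W.torsionGaloisModule ((2 ^ 2 : ℕ) : ℤ)) l' 1 ((2 : ℕ) • Z))
            (galoisCohomology.localization (W.torsionGaloisModule ((2 ^ 2 : ℕ) : ℤ)) l' 1 y) = 0 := by
  haveI : NeZero (2 ^ 2) := ⟨by norm_num⟩
  -- the deep places are those of `s ∪ t` outside `s`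
  have ht4' : ∀ (v : HeightOneSpectrum (𝓞 ℚ)) (ℓ : ℕ), ℓ.Prime → Sum.inr v ∈ s ∪ t → Sum.inr v ∉ s → (ℓ : 𝓞 ℚ) ∈ v.asIdeal →
      FrobEqFrobInfty W K (2 ^ 2) ℓ := fun v ℓ hℓ hvT hvs hv ↦
    ht4 v ℓ hℓ ((Finset.mem_union.mp hvT).resolve_left hvs) hv
  obtain ⟨y, hyKO, hy2, hdeep⟩ := exists_auxiliary_four_two_nsmul_ne_zero_deep W e hμ hadd₁ hadd₂ hgal halt hnondeg inv hΔ hρ2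
    (s ∪ t) s Finset.subset_union_left hs hTK ht4' hinv
  refine ⟨y, hyKO, hy2, fun l' hl' Z hX hXs hZt ↦ ?_⟩
  have hl's : l' ∉ s := fun h ↦ hl' (Finset.mem_union_left t h)
  have hl't : l' ∉ t := fun h ↦ hl' (Finset.mem_union_right s h)
  have hy' : y ∈ kummerOutside W (2 ^ 2) (insert l' (s ∪ t)) :=
    kummerOutside_mono W (2 ^ 2) (Finset.subset_insert l' (s ∪ t)) hyKO
  refine invWeilPairing_eq_zero_of_bottomRung_of_vanishing W (2 ^ 2) e hμ hadd₁ hadd₂ hgal halt hsum s t l' hl's hl't hst hX hy'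
    hXs fun u hu ↦ ?_
  -- a deep own place is `Sum.inr v` with `Sum.inr v ∈ t`, `∉ s`
  obtain ⟨v, ℓ, hℓp, huv, -⟩ := hTK u (Finset.mem_union_right s hu)
  subst huv
  have hvs : (Sum.inr v : Place ℚ) ∉ s := fun h ↦ Finset.disjoint_left.mp hst h hu
  exact hdeep v (Finset.mem_union_right s hu) hvs Z (hZt v hu)

end Engine

/-! ## §4 The same for the TWIN `Wd ≅ E^{(d_K)}` at the Kolyvagin primes of `(E, K)` (the `(−)`-side of the engine) -/

section Twin

open Summit.BirchSwinnertonDyer.BirchSwinnertonDyer.Theorems.GenusExact.TwinGrossPrimes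

variable (W : WeierstrassCurve ℚ) [W.IsElliptic] [W.IsGloballyMinimal]
variable (Wd : WeierstrassCurve ℚ) [Wd.IsElliptic] [Wd.IsGloballyMinimal]
variable (e : geomTorsion Wd ((2 ^ 2 : ℕ) : ℤ) → geomTorsion Wd ((2 ^ 2 : ℕ) : ℤ) → AlgebraicClosure ℚ)
  (hμ : ∀ S T, e S T ^ (2 ^ 2) = 1)
  (hadd₁ : ∀ S₁ S₂ T, e (S₁ + S₂) T = e S₁ T * e S₂ T)
  (hadd₂ : ∀ S T₁ T₂, e S (T₁ + T₂) = e S T₁ * e S T₂)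
  (hgal : ∀ (σ : absoluteGaloisGroup ℚ) (S T : geomTorsion Wd ((2 ^ 2 : ℕ) : ℤ)), σ • e S T = e (σ • S) (σ • T))
  (halt : ∀ T, e T T = 1) (hnondeg : ∀ T, (∀ S, e S T = 1) → T = 0)
  (inv : LocalInvariants ℚ (2 ^ 2))

include halt hnondeg in
/-- **Auxiliary + reciprocity on the twin side.**  For a globally minimal model `Wd` of `E^{(d_K)}` (`K` imaginary quadratic, `d_K` odd),
the hypotheses of `exists_auxiliary_bottomRung` transfer from `E` to `Wd` at the Gross–Kolyvagin primes `ℓ ∤ d_K` of `(E, K)` (`Δ(Wd) < 0`,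
`ρ̄_{Wd,2}` onto, good reduction, `Frob_ℓ = Frob_∞` on `Wd[2]` resp. `Wd[4]`, equal Kolyvagin index — tree `…TwinGrossPrimes`, the LEAD's
p701030 transfer block): the same conclusion for `H¹(ℚ, Wd[4])`. [cite: McCallumLMS1991, §5 proof of Prop. 5.2] [cite: GrossLMS1991, §3 (3.2)–(3.3)] -/
theorem exists_auxiliary_bottomRung_twin {K : Type} [Field K] [NumberField K]
    (hK : IsImaginaryQuadratic K) (hodd : Odd (NumberField.discr K)) (hΔ : W.Δ < 0) (hρ2 : W.HasSurjectiveModNGaloisRep 2)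
    {C : VariableChange ℚ} (hC : C • W.quadraticTwist ((NumberField.discr K : ℤ) : ℚ) = Wd)
    (s t : Finset (Place ℚ)) (hst : Disjoint s t) (hs : s.Nonempty)
    (hTK : ∀ u ∈ s ∪ t, ∃ (v : HeightOneSpectrum (𝓞 ℚ)) (ℓ : ℕ) (_ : Fact ℓ.Prime), u = Sum.inr v ∧ ℓ ≠ 2 ∧ (ℓ : 𝓞 ℚ) ∈ v.asIdeal ∧
      ¬ ((ℓ : ℤ) ∣ NumberField.discr K) ∧ W.HasGoodReductionAtPrime ℓ ∧ FrobEqFrobInfty W K 2 ℓ ∧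
      2 ≤ Zhang2014.kolyvaginIndex W 2 ℓ)
    (ht4 : ∀ (v : HeightOneSpectrum (𝓞 ℚ)) (ℓ : ℕ), ℓ.Prime → Sum.inr v ∈ t → (ℓ : 𝓞 ℚ) ∈ v.asIdeal →
      FrobEqFrobInfty W K (2 ^ 2) ℓ)
    (hinv : ∀ v : HeightOneSpectrum (𝓞 ℚ), Sum.inr v ∈ s ∪ t → Injective (inv (Sum.inr v)))
    (hsum : inv.SumLocalTermEqZero) :
    ∃ y ∈ kummerOutside Wd (2 ^ 2) (s ∪ t), 2 • y ≠ 0 ∧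
      ∀ l' : Place ℚ, l' ∉ s ∪ t →
        ∀ Z : galoisCohomology (Wd.torsionGaloisModule ((2 ^ 2 : ℕ) : ℤ)) 1,
          (2 : ℕ) • Z ∈ kummerOutside Wd (2 ^ 2) (insert l' (s ∪ t)) →
          (∀ u ∈ s, galoisCohomology.localization (Wd.torsionGaloisModule ((2 ^ 2 : ℕ) : ℤ)) u 1 ((2 : ℕ) • Z) = 0) →
          (∀ v : HeightOneSpectrum (𝓞 ℚ), Sum.inr v ∈ t →
            ∀ 𝔓 ∈ v.primesAbove, ∀ F c₀ : absoluteGaloisGroup ℚ, IsArithFrobAt (𝓞 ℚ) F 𝔓 →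
              IsComplexConjugation (Rat.castHom ℝ) c₀ → (∀ P : geomTorsion Wd ((2 ^ 2 : ℕ) : ℤ), F • P = c₀ • P) →
              ∃ P₁ : geomTorsion Wd ((2 ^ 2 : ℕ) : ℤ), h1Eval Wd _ ((2 : ℕ) • Z) F = F • P₁ - P₁) →
          invWeilPairing Wd (2 ^ 2) e hμ hadd₁ hadd₂ hgal inv l'
            (galoisCohomology.localization (Wd.torsionGaloisModule ((2 ^ 2 : ℕ) : ℤ)) l' 1 ((2 : ℕ) • Z))
            (galoisCohomology.localization (Wd.torsionGaloisModule ((2 ^ 2 : ℕ) : ℤ)) l' 1 y) = 0 := by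
  have hd : ((NumberField.discr K : ℤ) : ℚ) ≠ 0 := by exact_mod_cast NumberField.discr_ne_zero K
  have hΔ' : Wd.Δ < 0 := Δ_neg_of_smul_quadraticTwist_eq W hd Wd hC hΔ
  have hρ2' : Wd.HasSurjectiveModNGaloisRep 2 := by
    rw [← hC]
    exact hasSurjectiveModNGaloisRep_smul _ C 2 ((hasSurjectiveModNGaloisRep_two_quadraticTwist_iff W hd).mpr hρ2)
  refine exists_auxiliary_bottomRung Wd e hμ hadd₁ hadd₂ hgal halt hnondeg inv hΔ' hρ2' (K := K) s t hst hs (fun u hu ↦ ?_)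
    (fun v ℓ hℓ hvt hv ↦ frobEqFrobInfty_of_smul_quadraticTwist_eq W hK Wd hC (ht4 v ℓ hℓ hvt hv)) hinv hsum
  obtain ⟨v, ℓ, hℓp, huv, hℓ2, hv, hℓd, hgood, hFrob, hidx⟩ := hTK u hu
  refine ⟨v, ℓ, hℓp, huv, hℓ2, hv, hasGoodReductionAtPrime_of_smul_quadraticTwist_eq W hK.1 hodd Wd hC hℓd hgood,
    frobEqFrobInfty_of_smul_quadraticTwist_eq W hK Wd hC hFrob, ?_⟩
  rwa [kolyvaginIndex_eq_of_smul_quadraticTwist_eq W hK.1 hodd Wd hC hℓ2 hℓd hgood 2]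

end Twin

end Summit.BirchSwinnertonDyer.BirchSwinnertonDyer.Theorems.GenusExact.DeepOwnPrime

end
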